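import Mathlib
import Summits.QuantumFields.QCD.Theses.GaussianLinkFrames
import Summits.QuantumFields.QCD.Theorems.PauliWegnerSeaFMClosureUnquenchedDefs
import Summits.QuantumFields.QCD.Theorems.PauliWegnerSeaFMClosureUnquenchedRepairedC2

/-!
# Line `sibling-graft` — skeleton for crux `GaussianLinkFrames.FrameFMClosure` (stmt-QuantumFields-17375)

Crux (fixed, by name): `FrameFMClosure = FrameAPrioriBound → Core`,
`Core = ∀ N_f reg m > 0, Input → Conclusion` — the one-scale (log-scale shell) phase-quenched
fractional-moment input implies clause (ii) of `WilsonMobilityGap.MobilityGap`.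

## The transfer finding this skeleton certifies

`Core` is BYTE-IDENTICAL with the core of the sibling crux `PauliWegnerSea.FMClosureUnquenched`
(stmt-QuantumFields-11512, `= K1 → K3 → Core`), whose leads (c1, c2) landed the whole
Aizenman–Schenker–Friedrich–Hundertmark bootstrap in phase-quenched lattice QCD under
`Theorems/PauliWegnerSeaFMClosureUnquenched*.lean` (vocabulary `VonMisesCircles.*`: `Input`, `Conclusion`,
`TwoStarBounds`, `FarStability`, `CollarResolventBounds` [landed], `HoppingDecay` [landed],
`UnitShellLowerBound`, `InwardExtension`, `LocalCofactorDomination` = K1♭, `FibreBandLaw` [landed],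
`SideWitness` [landed]; closure `VonMisesCirclesC1.stub_closure` [landed]; reductions `VonMisesCirclesC2.*` [landed]).
Hence `frame_iff : FrameFMClosure ↔ (FrameAPrioriBound → ∀ …, Input → Conclusion)` is `Iff.rfl`, and the
sibling's three OPEN registered stubs imply THIS crux by name with the route hypothesis `FrameAPrioriBound`
UNUSED (`core_of_three` + `FrameFMClosure_of_stubs`, kernel-checked below):

* `stub_localCofactorDomination : LocalCofactorDomination` — K1♭, uniform two-star cofactor domination
  (deterministic, measure-free; partial: landed on the hopping window `41/10 ≤ |m₀+4|`,
  `VonMisesCirclesC2B.localCofactorDomination_of_window`; open on `|m₀+4| < 41/10`; numerics C₀ ≈ 25);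
* `stub_farStability : ∀ N_f, FarStability N_f` — collar quasi-independence of the phase-quenched measure
  `ν = ‖det‖·μ_W` (the physical stub; the sibling registers it threaded through its own K1, K3 — equivalent
  given K1♭ ⇒ K1 and K3 proved);
* `stub_corners` — A5 (unit shell) ∧ A6 (inward window): the part of `Core` AS TYPED that the sibling's
  leads and disprover hold MISSTATED (`Cruxes/FMClosureUnquenched/Disproof.lean` §4 `core_imp_nnCriterion`,
  §5 `not_abstractFMClosureRepaired`; `K2Repaired.lean`).  Inherited verbatim by this crux.

WHY THE FRAME IS NOT USED (strategist census `STRATEGY-CENSUS.md`, this crux dir): the Hubbard–Stratonovich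
disintegration `μ_W = E_aux ⊗_e ν_{J_e(aux)}` is an identity for `μ_W`; (i) at the two-star fibre the
von Mises–Fisher tilt is a degree-1 circle tilt already inside the sibling's `CircleLaw`/`FibreBandLaw`
engine, and the residual difficulty is the measure-free K1♭; (ii) across a collar, conditional independence
of `aux` given `U` turns `E_Λ[α(aux) ψ(aux)]` back into `E_{μ_W}[ᾱ ψ̄]` (the resampling operator
`U → aux → U'` is `μ_W`-reversible), so "bad frames are sparse" is far stability of `μ_W` again, and the
`‖det‖` coupling is untouched; (iii) `FrameAPrioriBound` as typed (whole-torus product average, det-free)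
cannot feed `‖det‖`-tilted fibre bounds without an `e^{O(volume)}` flatness loss.

§1 unbundling · §2 the three stubs · §3 kernel-checked composition · §4 restatement candidates for the
tenure planner (R1 outward-only, kernel-reduced to K1♭ + far stability; R3 profiled, typed only).

References: Aizenman–Schenker–Friedrich–Hundertmark, CMP 224 (2001) 219 [AizenmanEtAl2001];
Aizenman–Warzel, *Random Operators* (AMS 2015) ch. 11 [AizenmanWarzel2015]; Vairinhos–de Forcrand,
arXiv:1409.8442 [VairinhosDeforcrand2014].
-/

noncomputable section

namespace Summit.QuantumFields.QCD.Cruxes.FrameFMClosure.SiblingGraft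

open scoped BigOperators
open MeasureTheory Filter
open Literature.MathematicalPhysics.QuantumFieldTheory Literature.MathematicalPhysics.QuantumLattice
  Literature.Probability.LatticeModels
open Summit.QuantumFields.QCD.Theorems.VonMisesCircles
open Summit.QuantumFields.QCD.Theorems.VonMisesCirclesC1
open Summit.QuantumFields.QCD.Theorems.VonMisesCirclesC2

/-! ## §1 The crux unbundled -/

/-- `FrameFMClosure` is literally `FrameAPrioriBound → ∀ N_f reg m > 0, Input → Conclusion` in the sibling's
landed vocabulary (definitional unfolding, cf. `VonMisesCircles.crux_iff`). -/
theorem frame_iff :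
    Summit.QuantumFields.QCD.Theses.GaussianLinkFrames.FrameFMClosure ↔
      (Summit.QuantumFields.QCD.Theses.GaussianLinkFrames.FrameAPrioriBound →
        ∀ (Nf : ℕ) (reg : QCDRegularisation Nf) (m : Fin Nf → ℝ), (∀ f, 0 < m f) →
          Input Nf reg m → Conclusion Nf reg m) :=
  Iff.rfl

/-! ## §2 Registered stubs (all three SHARED with the registered skeleton of stmt-QuantumFields-11512,
`Cruxes/FMClosureUnquenched/Lines/von_mises_circles_c1.lean` / `_c2.lean`) -/

/-- **stub 1 — K1♭, uniform (local) cofactor domination** (L; deterministic linear algebra on the two-star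
fibre; byte-identical with the sibling's `stub_localCofactorDomination`).  One `C₀` with
`sup_fibre ‖adj(D_A ⊕ 1)_{xy}‖₁ ≤ C₀ · sup_fibre |det(D_A ⊕ 1)|` for every admissible side `A`, background,
`x, y ∈ A` (diagonal included) and probe mass `m₀ ∈ [-9, 1]`.  Landed on the hopping window
(`VonMisesCirclesC2B.localCofactorDomination_of_window`, `C₀ = 5904`); open for `|m₀ + 4| < 41/10`, where it is
stmt-11510's realisability question in uniform side-matrix dress (numerics of leads c1/c2: ratio ∈ [7, 23] over
160 backgrounds + adversarial searches, no volume growth).  Why plausibly true: γ₅-hermiticity of every side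
matrix (adjugate pole-free, each pole of `G` carries the same `H_W`-eigenvector at both ends; two stars shake
every mode cored at `x` or `y`).  The frame does not bear on it (measure-free statement). -/
theorem stub_localCofactorDomination : LocalCofactorDomination := by
  sorry

/-- **stub 2 — far stability of the exit moment across a thick collar, every `N_f`** (XL, HARDEST; the one
property of the phase-quenched measure `ν = ‖det‖·μ_W` replacing independence in ASFH:
`E[A Ψ] ≤ C(1+|β|)^p(1+ℓ)^p ((E A)^θ + E A) E Ψ` for the inside factor `A = ‖G_W(x,u)‖^s` and the far factor
`Ψ = ‖G_{Λᶜ}(v',y)‖^s`).  Unthreaded form of the sibling's `stub_farStability` (there typed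
`K1 → K3 → ∀ N_f, FarStability N_f`; K3 is proved and K1♭ ⇒ K1, so the two forms are interchangeable for a prover
holding stub 1), and verbatim the hypothesis `hF` of the landed
`VonMisesCirclesC2.outward_of_localCofactorDomination_farStability`.  The Gaussian link frame gives NO leverage
here (census §Transfer: the aux-resampling operator is `μ_W`-reversible, so frame-level far stability IS
`μ_W`-level far stability). -/
theorem stub_farStability : ∀ Nf : ℕ, FarStability Nf := by
  sorry

/-- **stub 3 — the corners A5 ∧ A6 of `Core` as typed** (unit-shell lower bound, inward extension;
byte-identical with the sibling's `stub_corners`).  This is the part of the crux that the sibling's leads and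
standing disprover hold MISSTATED rather than provable (`Disproof.lean` §4–§5 of stmt-11512; restatement
`K2Repaired.lean`; §4 below types the analogous restatements of THIS crux).  Carried so that the composition
concludes the crux AS TYPED by name; not attacked by this line. -/
theorem stub_corners :
    (∀ Nf : ℕ, UnitShellLowerBound Nf) ∧
      (∀ (Nf : ℕ) (reg : QCDRegularisation Nf) (m : Fin Nf → ℝ), (∀ f, 0 < m f) →
        InwardExtension Nf reg m) := by
  sorry

/-! ## §3 Kernel-checked composition -/

/-- **Composition, core form.** K1♭, far stability and the corners imply the unbundled crux (the route hypothesis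
`FrameAPrioriBound` is introduced and never used).  Logic: K1♭ gives the two-star package
(`twoStarBounds_of_localCofactorDomination`, fibre band law and side witnesses being theorems); the landed
closure `VonMisesCirclesC1.stub_closure` turns (two-star, far stability, collar resolvent bounds [theorem],
unit-shell corner, hopping decay [theorem], `Input`) into the outward package; the inward corner gives the
complementary package at the same exponent; `conclusion_of_outward_inward` merges them. -/
theorem core_of_three :
    LocalCofactorDomination →
    (∀ Nf : ℕ, FarStability Nf) →
    ((∀ Nf : ℕ, UnitShellLowerBound Nf) ∧
      (∀ (Nf : ℕ) (reg : QCDRegularisation Nf) (m : Fin Nf → ℝ), (∀ f, 0 < m f) →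
        InwardExtension Nf reg m)) →
    (Summit.QuantumFields.QCD.Theses.GaussianLinkFrames.FrameAPrioriBound →
      ∀ (Nf : ℕ) (reg : QCDRegularisation Nf) (m : Fin Nf → ℝ), (∀ f, 0 < m f) →
        Input Nf reg m → Conclusion Nf reg m) := by
  intro hK hF hc _hFAB Nf reg m hm hin
  have hT : TwoStarBounds Nf := twoStarBounds_of_localCofactorDomination hK Nf
  obtain ⟨s, δ, C, K₀, ℓ₀, hout⟩ :=
    _root_.Summit.QuantumFields.QCD.Theorems.VonMisesCirclesC1.stub_closure Nf reg m hm hT (hF Nf)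
      collarResolventBounds_holds (hc.1 Nf) (hoppingDecay_holds Nf) hin
  obtain ⟨δ', C', hinw⟩ := hc.2 Nf reg m hm hT hin s δ C K₀ ℓ₀ hout
  exact conclusion_of_outward_inward reg m hout hinw

/-- **The skeleton theorem**: the crux BY NAME from the three registered stubs (`frame_iff` + `core_of_three`); the only
theorem of this file concluding `FrameFMClosure`, hypothesis-free, sorries exactly inside the three `stub_*`. -/
theorem FrameFMClosure_of_stubs :
    Summit.QuantumFields.QCD.Theses.GaussianLinkFrames.FrameFMClosure :=
  frame_iff.mpr (core_of_three stub_localCofactorDomination stub_farStability stub_corners)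

/-! ## §4 Restatement candidates for the tenure planner (nothing here is a stub)

The corners of stub 3 are inherited from the shared clause-(ii) interface of `WilsonMobilityGap.MobilityGap`.
Two typed candidates, with what is kernel-checked about each. -/

/-- One-scale input WITH `2 ≤ ℓ₀` (A5 removed; free for the assembly, since the trajectory item only supplies
log-scale shells — `Disproof.lean` §4 `coreRepaired_of_core` of stmt-11512). -/
def InputTwo (Nf : ℕ) (reg : QCDRegularisation Nf) (m : Fin Nf → ℝ) : Prop :=
  ∀ q : ℕ, ∃ K₀ s : ℝ, 0 < s ∧ s < 1 ∧ ∀ᶠ k in atTop, ∃ ℓ₀ : ℕ, 2 ≤ ℓ₀ ∧ ℓ₀ ≤ reg.L k ∧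
    (ℓ₀ : ℝ) * reg.a k ≤ K₀ * (1 + |Real.log (reg.a k)|) ∧
    ∀ S : ℕ, reg.L k ≤ S → ∀ (f : Fin Nf) (v : Literature.Probability.LatticeModels.Site 4),
      v ∈ box 4 S → ‖v‖ = (ℓ₀ : ℝ) →
        (ℓ₀ : ℝ) ^ q * (1 + |reg.β k|) ^ q * cruxMoment Nf (reg.β k) (bareMass reg m k) S f v s ≤ 1

/-- Clause (ii) OUTWARD: decay for `K (1 + |log a_k|) ≤ a_k ‖v‖` only (A6 removed). -/
def OutwardConclusion (Nf : ℕ) (reg : QCDRegularisation Nf) (m : Fin Nf → ℝ) : Prop :=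
  ∃ s δ C K : ℝ, 0 < s ∧ s < 1 ∧ 0 < δ ∧ ∀ᶠ k in atTop, ∀ S : ℕ, reg.L k ≤ S →
    ∀ (f : Fin Nf) (v : Literature.Probability.LatticeModels.Site 4), v ∈ box 4 S →
      K * (1 + |Real.log (reg.a k)|) ≤ reg.a k * ‖v‖ →
        cruxMoment Nf (reg.β k) (bareMass reg m k) S f v s ≤ C * Real.exp (-(δ * (reg.a k * ‖v‖)))

/-- **R1 — `FrameFMClosureOutward`**: the crux with the refuter's clause-(i) hypothesis added (rreview
0817T01-3: `closes` already holds `hi` at the call site), input `2 ≤ ℓ₀`, conclusion outward.  A WEAKENING of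
the crux as typed (`outward_of_frameFMClosure`) that is CLOSED modulo K1♭ and far stability
(`frameFMClosureOutward_of_two`).  Caveat (census §Negation): outward-only decay starts at the physically
DIVERGING radius `K(1+|log a_k|)`, so R1 feeds the downstream items only after they are re-asked too. -/
def FrameFMClosureOutward : Prop :=
  Summit.QuantumFields.QCD.Theses.GaussianLinkFrames.FrameAPrioriBound →
    ∀ (Nf : ℕ) (reg : QCDRegularisation Nf) (m : Fin Nf → ℝ), (∀ f, 0 < m f) →
      (∀ f : Fin Nf, ∀ᶠ k in atTop, -1 < reg.mcrit k + reg.a k * m f / reg.Zm k) →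
        InputTwo Nf reg m → OutwardConclusion Nf reg m

/-- R1 is closed modulo K1♭ and far stability (the frame hypothesis, mass positivity and clause (i) are
not needed), by the landed `VonMisesCirclesC2.outward_of_localCofactorDomination_farStability`. -/
theorem frameFMClosureOutward_of_two (hK : LocalCofactorDomination) (hF : ∀ Nf : ℕ, FarStability Nf) :
    FrameFMClosureOutward := by
  intro _ Nf reg m _ _ hin
  obtain ⟨s, δ, C, K₀, ℓ₀, hs0, hs1, hδ, _hC, hwin, -, hdec⟩ :=
    outward_of_localCofactorDomination_farStability hK hF Nf reg m hin
  refine ⟨s, δ, C, K₀, hs0, hs1, hδ, ?_⟩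
  filter_upwards [hwin, hdec] with k hkwin hk S hS f v hv hfar
  have hℓ : (ℓ₀ k f : ℝ) ≤ ‖v‖ := by
    have ha : 0 < reg.a k := reg.a_pos k
    have h1 : (ℓ₀ k f : ℝ) * reg.a k ≤ reg.a k * ‖v‖ := (hkwin f).trans hfar
    nlinarith
  exact hk S hS f v hv hℓ

/-- R1 is a weakening of the crux as typed. -/
theorem outward_of_frameFMClosure
    (h : Summit.QuantumFields.QCD.Theses.GaussianLinkFrames.FrameFMClosure) : FrameFMClosureOutward := by
  intro hFAB Nf reg m hm _ hin
  have hin' : Input Nf reg m := by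
    intro q
    obtain ⟨K₀, s, hs0, hs1, hev⟩ := hin q
    exact ⟨K₀, s, hs0, hs1, hev.mono fun k ⟨ℓ₀, h2, hL, ha, hsh⟩ => ⟨ℓ₀, by omega, hL, ha, hsh⟩⟩
  obtain ⟨s, δ, C, hs0, hs1, hδ, hev⟩ := (frame_iff.mp h) hFAB Nf reg m hm hin'
  exact ⟨s, δ, C, 0, hs0, hs1, hδ, hev.mono fun k hk S hS f v hv _ => hk S hS f v hv⟩

/-- Inward power-law PROFILE of the phase-quenched moment (candidate extra INPUT, to be supplied by the
trajectory item: the canonical `‖v‖^{-3}` short-distance law of the 4-d lattice quark propagator in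
fractional mean, constants polynomial in `β_k`). -/
def InwardProfile (Nf : ℕ) (reg : QCDRegularisation Nf) (m : Fin Nf → ℝ) : Prop :=
  ∀ s : ℝ, 0 < s → s < 1 → ∃ c C p : ℝ, 0 < c ∧ 0 ≤ C ∧ 0 ≤ p ∧ ∀ᶠ k in atTop, ∀ S : ℕ, reg.L k ≤ S →
    ∀ (f : Fin Nf) (v : Literature.Probability.LatticeModels.Site 4), v ∈ box 4 S →
      cruxMoment Nf (reg.β k) (bareMass reg m k) S f v s ≤ C * (1 + |reg.β k|) ^ p * (1 + ‖v‖) ^ (-c)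

/-- Clause (ii) with a polynomial-in-`β_k` prefactor (what fibre methods can give at `v = 0`: every
two-star constant is `(1+|β|)^p`; a `k`-uniform constant at `v = 0` on an asymptotically free trajectory
would need a `β`-UNIFORM a-priori bound — corner A7′ of the census). -/
def ConclusionBeta (Nf : ℕ) (reg : QCDRegularisation Nf) (m : Fin Nf → ℝ) : Prop :=
  ∃ s δ C p : ℝ, 0 < s ∧ s < 1 ∧ 0 < δ ∧ ∀ᶠ k in atTop, ∀ S : ℕ, reg.L k ≤ S →
    ∀ (f : Fin Nf) (v : Literature.Probability.LatticeModels.Site 4), v ∈ box 4 S →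
      cruxMoment Nf (reg.β k) (bareMass reg m k) S f v s ≤
        C * (1 + |reg.β k|) ^ p * Real.exp (-(δ * (reg.a k * ‖v‖)))

/-- **R3 — `FrameFMClosureProfiled`**: input `2 ≤ ℓ₀` AND the inward profile ⇒ clause (ii) for ALL `v`
with a `(1+|β_k|)^p` prefactor.  A weakening of the crux as typed (`profiled_of_frameFMClosure`) that is
CLOSED modulo K1♭ and far stability (`frameFMClosureProfiled_of_two`, via the elementary merging lemma
`conclusionBeta_of_outward_profile`: for `‖v‖ < ℓ₀`, `a_k ℓ₀ ≤ K₀(1+|log a_k|)` and `a_k ≤ 1` one has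
`δ'' a_k ‖v‖ − c log(1+‖v‖) ≤ δ''(K₀+1)` once `2δ''(K₀+1) ≤ c`, `inward_exponent_bound`).  So with the inward
profile moved to the INPUT side, the honest content of the closure is again exactly K1♭ + far stability; the
`(1+|β_k|)^p` prefactor is what remains of corner A7′. -/
def FrameFMClosureProfiled : Prop :=
  Summit.QuantumFields.QCD.Theses.GaussianLinkFrames.FrameAPrioriBound →
    ∀ (Nf : ℕ) (reg : QCDRegularisation Nf) (m : Fin Nf → ℝ), (∀ f, 0 < m f) →
      (∀ f : Fin Nf, ∀ᶠ k in atTop, -1 < reg.mcrit k + reg.a k * m f / reg.Zm k) →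
        InputTwo Nf reg m → InwardProfile Nf reg m → ConclusionBeta Nf reg m

/-- The elementary inequality behind the inward window: `a ∈ (0,1]`, `r ≥ 0`, `a r ≤ K₀(1+|log a|)`,
`2δ''(K₀+1) ≤ c` ⇒ `δ'' a r − c log(1+r) ≤ δ''(K₀+1)` (cases `r²a ≥ 1`: `|log a| ≤ 2 log(1+r)`; `r²a < 1`:
`a r ≤ 1`). [folklore] -/
theorem inward_exponent_bound {a r K₀ c δ'' : ℝ} (ha0 : 0 < a) (ha1 : a ≤ 1) (hr : 0 ≤ r) (hK : 0 ≤ K₀)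
    (hc : 0 < c) (hδ : 0 < δ'') (hδc : 2 * δ'' * (K₀ + 1) ≤ c) (har : a * r ≤ K₀ * (1 + |Real.log a|)) :
    δ'' * (a * r) - c * Real.log (1 + r) ≤ δ'' * (K₀ + 1) := by
  have hlog1r : 0 ≤ Real.log (1 + r) := Real.log_nonneg (by linarith)
  have hring : δ'' * (K₀ + 1) = δ'' * K₀ + δ'' := by ring
  by_cases hcase : 1 ≤ r * r * a
  · -- far inside the window: `|log a| ≤ 2 log (1 + r)`
    have hr1 : 1 ≤ r := by
      by_contra h
      push Not at h
      have h1 : r * r ≤ r := by nlinarith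
      have h2 : r * r * a ≤ r * r := by nlinarith [mul_nonneg hr hr]
      nlinarith
    have hrpos : 0 < r := by linarith
    have hloga : |Real.log a| = -Real.log a := abs_of_nonpos (Real.log_nonpos ha0.le ha1)
    have hinv : 1 / a ≤ r * r := by
      rw [div_le_iff₀ ha0]
      linarith [hcase]
    have hlogle : -Real.log a ≤ 2 * Real.log (1 + r) := by
      have h1 : -Real.log a = Real.log (1 / a) := by rw [one_div, Real.log_inv]
      have h2 : Real.log (1 / a) ≤ Real.log (r * r) := Real.log_le_log (by positivity) hinv
      have h3 : Real.log (r * r) = 2 * Real.log r := by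
        rw [Real.log_mul hrpos.ne' hrpos.ne']; ring
      have h4 : Real.log r ≤ Real.log (1 + r) := Real.log_le_log hrpos (by linarith)
      linarith
    have h5 : a * r ≤ K₀ * (1 + 2 * Real.log (1 + r)) := by
      calc a * r ≤ K₀ * (1 + |Real.log a|) := har
        _ ≤ K₀ * (1 + 2 * Real.log (1 + r)) := by
            apply mul_le_mul_of_nonneg_left _ hK
            rw [hloga]; linarith
    have h6 : δ'' * (a * r) ≤ δ'' * K₀ + 2 * δ'' * K₀ * Real.log (1 + r) := by
      have := mul_le_mul_of_nonneg_left h5 hδ.le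
      nlinarith [this]
    have h7' : 2 * δ'' * K₀ ≤ c := by nlinarith
    have h7 : 2 * δ'' * K₀ * Real.log (1 + r) ≤ c * Real.log (1 + r) :=
      mul_le_mul_of_nonneg_right h7' hlog1r
    linarith
  · -- near the origin: `a r ≤ 1`
    push Not at hcase
    have har1 : a * r ≤ 1 := by
      by_cases hr1 : r ≤ 1
      · nlinarith
      · push Not at hr1
        have h1 : a * r * 1 ≤ a * r * r := mul_le_mul_of_nonneg_left hr1.le (mul_nonneg ha0.le hr)
        have h2 : a * r * r = r * r * a := by ring
        linarith
    have h1 : δ'' * (a * r) ≤ δ'' := by nlinarith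
    have h2 : 0 ≤ c * Real.log (1 + r) := mul_nonneg hc.le hlog1r
    have h3 : 0 ≤ δ'' * K₀ := mul_nonneg hδ.le hK
    linarith

/-- **R3's merging lemma**: the outward package plus the inward profile give clause (ii) for ALL `v` with a
`(1+|β_k|)^p` prefactor (rate `min δ (c / (2 (max K₀ 0 + 1)))`, constant `max C (C_P e^{B})`). [folklore] -/
theorem conclusionBeta_of_outward_profile {Nf : ℕ} (reg : QCDRegularisation Nf) (m : Fin Nf → ℝ)
    {s δ C K₀ : ℝ} {ℓ₀ : ℕ → Fin Nf → ℕ}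
    (hout : OutwardDecayWith Nf reg m s δ C K₀ ℓ₀) (hprof : InwardProfile Nf reg m) :
    ConclusionBeta Nf reg m := by
  obtain ⟨hs0, hs1, hδ, hC, hwin, -, hdec⟩ := hout
  obtain ⟨c, CP, p, hc, hCP, hp, hev⟩ := hprof s hs0 hs1
  have ha1 : ∀ᶠ k in atTop, reg.a k ≤ 1 :=
    (reg.tendsto_a.eventually (gt_mem_nhds one_pos)).mono fun k hk => hk.le
  set K₁ : ℝ := max K₀ 0 with hK₁
  have hK₁0 : 0 ≤ K₁ := le_max_right _ _
  have hK₀₁ : K₀ ≤ K₁ := le_max_left _ _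
  have h2K : 0 < 2 * (K₁ + 1) := by positivity
  set δ'' : ℝ := min δ (c / (2 * (K₁ + 1))) with hδ''
  have hδ''0 : 0 < δ'' := lt_min hδ (div_pos hc h2K)
  have hδ''δ : δ'' ≤ δ := min_le_left _ _
  have hδ''c : 2 * δ'' * (K₁ + 1) ≤ c := by
    have h1 : δ'' ≤ c / (2 * (K₁ + 1)) := min_le_right _ _
    calc 2 * δ'' * (K₁ + 1) = δ'' * (2 * (K₁ + 1)) := by ring
      _ ≤ c / (2 * (K₁ + 1)) * (2 * (K₁ + 1)) := mul_le_mul_of_nonneg_right h1 h2K.le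
      _ = c := div_mul_cancel₀ c h2K.ne'
  set B : ℝ := δ'' * (K₁ + 1) with hB
  set C'' : ℝ := max C (CP * Real.exp B) with hC''
  have hC''0 : 0 ≤ C'' := hC.trans (le_max_left _ _)
  refine ⟨s, δ'', C'', p, hs0, hs1, hδ''0, ?_⟩
  filter_upwards [hwin, hdec, hev, ha1] with k hkwin hkdec hkprof hka S hS f v hv
  have hβ1 : 1 ≤ (1 + |reg.β k|) ^ p := Real.one_le_rpow (by linarith [abs_nonneg (reg.β k)]) hp
  have hβ0 : 0 ≤ (1 + |reg.β k|) ^ p := by positivity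
  have hx : 0 ≤ reg.a k * ‖v‖ := mul_nonneg (reg.a_pos k).le (norm_nonneg v)
  by_cases h : (ℓ₀ k f : ℝ) ≤ ‖v‖
  · -- outward region
    have h1 : Real.exp (-(δ * (reg.a k * ‖v‖))) ≤ Real.exp (-(δ'' * (reg.a k * ‖v‖))) :=
      Real.exp_le_exp.mpr (neg_le_neg (mul_le_mul_of_nonneg_right hδ''δ hx))
    have h2 : C ≤ C'' * (1 + |reg.β k|) ^ p := by
      calc C = C * 1 := (mul_one C).symm
        _ ≤ C'' * (1 + |reg.β k|) ^ p := mul_le_mul (le_max_left _ _) hβ1 zero_le_one hC''0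
    calc cruxMoment Nf (reg.β k) (bareMass reg m k) S f v s
        ≤ C * Real.exp (-(δ * (reg.a k * ‖v‖))) := hkdec S hS f v hv h
      _ ≤ C'' * (1 + |reg.β k|) ^ p * Real.exp (-(δ'' * (reg.a k * ‖v‖))) :=
          mul_le_mul h2 h1 (Real.exp_pos _).le (mul_nonneg hC''0 hβ0)
  · -- inward region
    push Not at h
    have hr : 0 ≤ ‖v‖ := norm_nonneg v
    have har : reg.a k * ‖v‖ ≤ K₁ * (1 + |Real.log (reg.a k)|) := by
      have h1 : reg.a k * ‖v‖ ≤ reg.a k * (ℓ₀ k f : ℝ) :=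
        mul_le_mul_of_nonneg_left h.le (reg.a_pos k).le
      have h2 : (ℓ₀ k f : ℝ) * reg.a k ≤ K₀ * (1 + |Real.log (reg.a k)|) := hkwin f
      have h3 : K₀ * (1 + |Real.log (reg.a k)|) ≤ K₁ * (1 + |Real.log (reg.a k)|) :=
        mul_le_mul_of_nonneg_right hK₀₁ (by positivity)
      have h4 : reg.a k * (ℓ₀ k f : ℝ) = (ℓ₀ k f : ℝ) * reg.a k := mul_comm _ _
      linarith
    have key := inward_exponent_bound (reg.a_pos k) hka hr hK₁0 hc hδ''0 hδ''c har
    have h1r : 0 < 1 + ‖v‖ := by linarith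
    have hpow : (1 + ‖v‖) ^ (-c) ≤ Real.exp B * Real.exp (-(δ'' * (reg.a k * ‖v‖))) := by
      rw [Real.rpow_def_of_pos h1r, ← Real.exp_add]
      apply Real.exp_le_exp.mpr
      rw [hB]
      nlinarith [key]
    calc cruxMoment Nf (reg.β k) (bareMass reg m k) S f v s
        ≤ CP * (1 + |reg.β k|) ^ p * (1 + ‖v‖) ^ (-c) := hkprof S hS f v hv
      _ ≤ CP * (1 + |reg.β k|) ^ p * (Real.exp B * Real.exp (-(δ'' * (reg.a k * ‖v‖)))) :=
          mul_le_mul_of_nonneg_left hpow (mul_nonneg hCP hβ0)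
      _ = (CP * Real.exp B) * (1 + |reg.β k|) ^ p * Real.exp (-(δ'' * (reg.a k * ‖v‖))) := by ring
      _ ≤ C'' * (1 + |reg.β k|) ^ p * Real.exp (-(δ'' * (reg.a k * ‖v‖))) := by
          apply mul_le_mul_of_nonneg_right _ (Real.exp_pos _).le
          exact mul_le_mul_of_nonneg_right (le_max_right _ _) hβ0

/-- R3 is closed modulo K1♭ and far stability (frame hypothesis, mass positivity, clause (i) unused). -/
theorem frameFMClosureProfiled_of_two (hK : LocalCofactorDomination) (hF : ∀ Nf : ℕ, FarStability Nf) :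
    FrameFMClosureProfiled := by
  intro _ Nf reg m _ _ hin hprof
  obtain ⟨s, δ, C, K₀, ℓ₀, hout⟩ := outward_of_localCofactorDomination_farStability hK hF Nf reg m hin
  exact conclusionBeta_of_outward_profile reg m hout hprof

/-- R3 is a weakening of the crux as typed. -/
theorem profiled_of_frameFMClosure
    (h : Summit.QuantumFields.QCD.Theses.GaussianLinkFrames.FrameFMClosure) : FrameFMClosureProfiled := by
  intro hFAB Nf reg m hm _ hin _
  have hin' : Input Nf reg m := by
    intro q
    obtain ⟨K₀, s, hs0, hs1, hev⟩ := hin q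
    exact ⟨K₀, s, hs0, hs1, hev.mono fun k ⟨ℓ₀, h2, hL, ha, hsh⟩ => ⟨ℓ₀, by omega, hL, ha, hsh⟩⟩
  obtain ⟨s, δ, C, hs0, hs1, hδ, hev⟩ := (frame_iff.mp h) hFAB Nf reg m hm hin'
  refine ⟨s, δ, C, 0, hs0, hs1, hδ, hev.mono fun k hk S hS f v hv => ?_⟩
  rw [Real.rpow_zero, mul_one]
  exact hk S hS f v hv

end Summit.QuantumFields.QCD.Cruxes.FrameFMClosure.SiblingGraft
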